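import Mathlib
import Literature.MathematicalPhysics.QuantumFieldTheory.Balaban1983to89.B5AveragingTorus

/-!
# Bałaban, *Propagators and renormalization transformations I* (B5) — the decay (1.126) of the kernel
`∂P∂*` from the representation `P = G′Q′*(Q′G′²Q′*)⁻¹Q′G′`: a kernel-checked edge to the inputs of [2]

T. Bałaban, Commun. Math. Phys. **95** (1984) 17–40, bib key `Balaban1984PropagatorsI`; [2] = B4 =
`Balaban1983RegularityDecay` (Commun. Math. Phys. **89** (1983) 571–597).  Renders read as images
(journal page = PDF page + 16): p. 25 [PDF 9], p. 26 [PDF 10], p. 38 [PDF 22].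

WHAT THE PAPER PRINTS.  p. 38, verbatim: *"Let us write bounds for the operator ∂P∂*. They follow from the
representation P = G′Q′*(Q′G′²Q′*)⁻¹Q′G′, from Lemma 2.4 of [2], and the representation (1.45) and the analyticity
method of proving an exponential decay (see the proof of Lemma 2.4 in [2]). We obtain
|(∂P∂*)_{μ,ν}(x, x′)| ≤ O(1)e^{−δ′₀|x−x′|}, (1.126)"* (the tree's NAMED leaf `B5.Kernel126_127Printed`, first
conjunct).  p. 25, verbatim: *"R = I − G′_kQ′*_k(Q′_kG′_k²Q′*_k)⁻¹Q′_kG′_k. (1.44)  Now all the operators appearing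
in these formulas are well defined. We have to verify it only for (Q′_kG′_k²Q′*_k)⁻¹. It is enough to prove that
Q′_kG′_k²Q′*_k is positive definite. … We have bounds 0 < Q′_kG′_k²Q′*_k ≤ a⁻², and they imply the existence of the
inverse operator and a bound from below."*  p. 26, verbatim (after (1.45)): *"From this representation and from the
bounds (2.51), (2.52) of that paper, it follows that there are positive constants γ₀, γ₁, in fact γ₀ dependent only on
d, γ₁ = a⁻², such that γ₀ ≤ Q′_kG′_k²Q′*_k ≤ γ₁. This property and the representation (1.44) are crucial for the later
considerations when we will have operators dependent on external gauge field."*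

WHAT THIS MODULE CERTIFIES (0 sorry; elementary; every analytic input a HYPOTHESIS shaped as the sentence that
supplies it).  Over an arbitrary carrier `X` with a pseudo-distance `dX` (`B4Sect5Torus.IsPseudoDist`), finite index
families positioned in `X` (fine sites/components `π : ι → X`, coarse points `σ : κ → X`) with lattice-sum profiles
(`PosProfile`, the positioned form of `B4Sect5Torus.SumBound`), and real kernels as matrices:
* `PosDecay.mul` — the composition of two exponentially decaying positioned kernels decays, with any smaller rate and
  the constant `c₁c₂K(gap)` (triangle inequality + the profile) [folklore];
* `PosDecay.inv` — **"the analyticity method of proving an exponential decay"** in its finite form: a COERCIVE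
  (`QGQInverse.Coercive S γ₀`, i.e. `γ₀ ≤ S`) exponentially decaying kernel has an exponentially decaying inverse,
  `|S⁻¹(y,y′)| ≤ (2/γ₀)e^{−δ₁ dX(σy,σy′)}`, `δ₁ = B4Sect5Torus.rate K γ₀ c₀ δ₀ > 0` — the tree's finite Combes–Thomas
  estimate `QGQInverse.inverse_decay` with the weighted Schur sums `B4Sect5Torus.weightedRowSum_le/ColSum_le`
  [folklore];
* `decay126` — for kernels `D, D′, G : ι×ι`, `B : κ×ι` (read `Q′`), `B⋆ : ι×κ` (read `Q′*`), all exponentially decaying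
  at a rate `δ > 0` (finite-range kernels are such, `PosDecay.of_finiteRange`), and `M := B·G·G·B⋆` coercive with
  constant `γ₀ > 0` (read: *"γ₀ ≤ Q′_kG′_k²Q′*_k"*, p. 26), the kernel `D·G·B⋆·M⁻¹·B·G·D′` (read: `∂ P ∂*` with
  `P = G′Q′*(Q′G′²Q′*)⁻¹Q′G′`) satisfies `|·(x,x′)| ≤ const126 · e^{−rate126·dX(πx,πx′)}` with `0 < rate126` — the
  explicit constant and rate `const126`, `rate126` (defs below) depend only on the input constants, `γ₀`, `δ` and the
  two profiles; `decay126_shape` restates it in the `∃ δ′₀ > 0, ∃ C > 0` shape of (1.126);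
* `PosDecay.row_diff`, `holder127` — the Hölder half **(1.127)** by the same mechanism: if two rows `x, x′` of
  `∂G′ = D·G` differ entrywise by `≤ h·e^{−δ·dX(πx,·)}` (read: the Hölder continuity of `∇G′` in Theorem 1 of [2],
  `h = O(1)|x − x′|^α`), the rows of `∂P∂*` differ by `≤ h·const127·e^{−rate126·dX(πx,πx″)}`;
  `kernel126_127_of_constituents` — the tree's leaf `B5.Kernel126_127Printed` ((1.126) ∧ (1.127), printed shape) for
  the family `(μ,ν) ↦ (∂_μP∂*_ν)(x,x′)` on a carrier of sites, DERIVED from the typed constituents;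
* `posProfile_torus`, `isPseudoDist_torusDist` — the profiles on the unit torus `B5TorusCover.UT N` of the averaging
  model `B5AveragingTorus` (uniform constant `m·K_d(a)`, `B4Sect5Torus.torusSum_le`), so that `decay126` instantiates on
  the carrier of `B5AveragingTorus.h128_balaban_torus`, whose only analytic hypothesis is exactly this decay;
  `h128_of_constituents` — that leaf, **(1.128)** for `Δ_a = Δ + aQ*Q − ∂P∂*` in the torus model, with (1.126)
  discharged down to the constituents: its only non-structural hypotheses are now (α) and (β) below;
  §2b + `decay126_torus_of_inv` / `h128_of_constituents_inv` — the VARIANT taking the decay (α″) of the kernel of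
  `(Q′G′²Q′*)⁻¹` as input instead of (β) (generic middle factor `Mi`; six `PosDecay.mul` steps, rate `δ/64`): then every
  non-structural hypothesis of the torus-model (1.128) is a kernel-decay estimate on a named operator.  The tree already
  holds kernel certificates, in the MULTIPLIER model of (1.45), of (α″) (`B5Torus145Decay.inverse145_torusKernelM_decay_torusMetric`,
  k- and volume-uniform) and of the (1.45) bounds (`B5.bound145_scalar`, repaired `γ₁(d)·a⁻²`, cell GAPS G-B5-13); what is
  NOT typed anywhere is the identification of the averaging-model matrices with those multipliers (Fourier diagonalisation
  of block averaging on the torus, [2] (2.43)–(2.48); p. 25 l. 35–36 «It is a translation invariant operator on the unit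
  lattice T₁^{(k)} and its Fourier transform can be written using formula (2.48)»).

WHAT IT DOES NOT CERTIFY (cell GAPS G-B5-34): (α) the decay of the kernels of `G′ = (−Δ^η_A)⁻¹`-type propagators and
of their covariant derivatives — Theorem 1 / Lemma 2.4 of [2] (tree NAMED FACT `B4.Lemma24Printed`), here the
hypotheses `hG`, `hD`, `hD'`, and (α′) the Hölder rows of `∂G′`, here `hE` / `hH`; (β) the coercivity
`γ₀ ≤ Q′G′²Q′*` — (1.45) with (2.51), (2.52) of [2], here `hM`; (γ) the identification of Bałaban's `∂`, `Q′`, `Q′*`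
(η-lattice, gauge field) with positioned matrices — a dictionary, not a theorem.  Value = kernel certificate of the
LOGIC of a located sentence (decay + Hölder rows of the constituents, coercivity ⟹ (1.126)–(1.127)), NOT summit
progress.
-/

namespace Literature.MathematicalPhysics.QuantumFieldTheory.Balaban1983to89.B5Decay126

open Finset
open B4Sect5Torus (IsPseudoDist SumBound weightC rate)
open B5TorusCover (UT)

noncomputable section

/-! ## §1  Positioned kernels with exponential decay -/

section Positioned

variable {X : Type*} {dX : X → X → ℝ}
variable {α β γ : Type*}

/-- `PosDecay dX pa pb A c δ`: the kernel `A : α × β → ℝ`, whose row index `a` sits at `pa a ∈ X` and column index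
`b` at `pb b ∈ X`, satisfies `|A(a,b)| ≤ c·e^{−δ·dX(pa a, pb b)}` with `c ≥ 0`.  The shape of (1.126) and of the
kernel bounds of [2]. [folklore] -/
def PosDecay (dX : X → X → ℝ) (pa : α → X) (pb : β → X) (A : Matrix α β ℝ) (c δ : ℝ) : Prop :=
  0 ≤ c ∧ ∀ a b, |A a b| ≤ c * Real.exp (-(δ * dX (pa a) (pb b)))

/-- `PosProfile dX pb K`: the lattice-sum profile of the positioned family `pb` seen from ANY point of the carrier,
`Σ_b e^{−t·dX(x, pb b)} ≤ K(t)` for `t > 0`. [folklore] -/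
def PosProfile [Fintype β] (dX : X → X → ℝ) (pb : β → X) (K : ℝ → ℝ) : Prop :=
  ∀ t : ℝ, 0 < t → ∀ x : X, ∑ b, Real.exp (-(t * dX x (pb b))) ≤ K t

omit dX in
/-- A positioned profile restricts to the tree's `SumBound` for the pulled-back pseudo-distance. [folklore] -/
theorem PosProfile.sumBound [Fintype β] {dX : X → X → ℝ} {pb : β → X} {K : ℝ → ℝ}
    (h : PosProfile dX pb K) : SumBound (fun b b' : β => dX (pb b) (pb b')) K :=
  fun t ht b => h t ht (pb b)

/-- Weakening the rate (nonnegative distances). [folklore] -/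
theorem PosDecay.mono {pa : α → X} {pb : β → X} {A : Matrix α β ℝ} {c δ δ' : ℝ}
    (hdX : ∀ x y, 0 ≤ dX x y) (h : PosDecay dX pa pb A c δ) (hδ' : δ' ≤ δ) : PosDecay dX pa pb A c δ' := by
  refine ⟨h.1, fun a b => (h.2 a b).trans ?_⟩
  apply mul_le_mul_of_nonneg_left _ h.1
  apply Real.exp_le_exp.mpr
  have := mul_le_mul_of_nonneg_right hδ' (hdX (pa a) (pb b))
  linarith

/-- Enlarging the constant. [folklore] -/
theorem PosDecay.const_mono {pa : α → X} {pb : β → X} {A : Matrix α β ℝ} {c c' δ : ℝ}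
    (h : PosDecay dX pa pb A c δ) (hc : c ≤ c') : PosDecay dX pa pb A c' δ :=
  ⟨h.1.trans hc, fun a b => (h.2 a b).trans (mul_le_mul_of_nonneg_right hc (Real.exp_pos _).le)⟩

/-- Transposition (symmetric distance). [folklore] -/
theorem PosDecay.transpose {pa : α → X} {pb : β → X} {A : Matrix α β ℝ} {c δ : ℝ}
    (hsymm : ∀ x y, dX x y = dX y x) (h : PosDecay dX pa pb A c δ) :
    PosDecay dX pb pa A.transpose c δ :=
  ⟨h.1, fun b a => by rw [Matrix.transpose_apply, hsymm]; exact h.2 a b⟩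

/-- Scalar multiples (e.g. `Q′* = η^d·Q′ᵀ`). [folklore] -/
theorem PosDecay.smul {pa : α → X} {pb : β → X} {A : Matrix α β ℝ} {c δ : ℝ}
    (h : PosDecay dX pa pb A c δ) (t : ℝ) : PosDecay dX pa pb (t • A) (|t| * c) δ := by
  refine ⟨mul_nonneg (abs_nonneg t) h.1, fun a b => ?_⟩
  rw [Matrix.smul_apply, smul_eq_mul, abs_mul, mul_assoc]
  exact mul_le_mul_of_nonneg_left (h.2 a b) (abs_nonneg t)

/-- A FINITE-RANGE bounded kernel (`A(a,b) = 0` unless `dX(pa a, pb b) ≤ r`, `|A| ≤ R₀`) decays at every rate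
`δ ≥ 0` with constant `R₀e^{δr}` (the local operators `∂`, `Q′`, `Q′*`). [folklore] -/
theorem PosDecay.of_finiteRange {pa : α → X} {pb : β → X} {A : Matrix α β ℝ} {R₀ r δ : ℝ}
    (hδ : 0 ≤ δ) (hR : 0 ≤ R₀) (hbd : ∀ a b, |A a b| ≤ R₀)
    (hrange : ∀ a b, r < dX (pa a) (pb b) → A a b = 0) :
    PosDecay dX pa pb A (R₀ * Real.exp (δ * r)) δ := by
  refine ⟨by positivity, fun a b => ?_⟩
  by_cases hfar : r < dX (pa a) (pb b)
  · rw [hrange a b hfar, abs_zero]; positivity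
  · have hle : dX (pa a) (pb b) ≤ r := not_lt.mp hfar
    calc |A a b| ≤ R₀ := hbd a b
      _ = R₀ * Real.exp (δ * r) * Real.exp (-(δ * r)) := by
          rw [mul_assoc, ← Real.exp_add, add_neg_cancel, Real.exp_zero, mul_one]
      _ ≤ R₀ * Real.exp (δ * r) * Real.exp (-(δ * dX (pa a) (pb b))) := by
          apply mul_le_mul_of_nonneg_left _ (by positivity)
          apply Real.exp_le_exp.mpr
          have := mul_le_mul_of_nonneg_left hle hδ
          linarith

/-- **Composition of decaying positioned kernels**: if `A : α×β` and `B : β×γ` decay at rates `δa, δb` and the middle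
family `pb` has profile `K`, then for every target rate `δ' ≥ 0` and gap `g > 0` with `δ' + g ≤ δa, δb` the product
`A·B` decays at rate `δ'` with constant `c₁c₂K(g)` (triangle inequality for `dX`, then the profile at rate `g`).
[folklore] -/
theorem PosDecay.mul [Fintype β] (hd : IsPseudoDist dX) {pa : α → X} {pb : β → X} {pc : γ → X} {K : ℝ → ℝ}
    (hK0 : ∀ t, 0 < t → 0 ≤ K t) (hK : PosProfile dX pb K)
    {A : Matrix α β ℝ} {B : Matrix β γ ℝ} {c₁ c₂ δa δb : ℝ}
    (hA : PosDecay dX pa pb A c₁ δa) (hB : PosDecay dX pb pc B c₂ δb)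
    {δ' g : ℝ} (hδ' : 0 ≤ δ') (hg : 0 < g) (hga : δ' + g ≤ δa) (hgb : δ' + g ≤ δb) :
    PosDecay dX pa pc (A * B) (c₁ * c₂ * K g) δ' := by
  refine ⟨mul_nonneg (mul_nonneg hA.1 hB.1) (hK0 g hg), fun a c => ?_⟩
  rw [Matrix.mul_apply]
  have key : ∀ b, |A a b * B b c| ≤ c₁ * c₂ * Real.exp (-(δ' * dX (pa a) (pc c))) *
      Real.exp (-(g * dX (pa a) (pb b))) := by
    intro b
    have hab := hd.nonneg (pa a) (pb b)
    have hbc := hd.nonneg (pb b) (pc c)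
    have htri := hd.triangle (pa a) (pb b) (pc c)
    rw [abs_mul]
    calc |A a b| * |B b c|
        ≤ (c₁ * Real.exp (-(δa * dX (pa a) (pb b)))) * (c₂ * Real.exp (-(δb * dX (pb b) (pc c)))) :=
          mul_le_mul (hA.2 a b) (hB.2 b c) (abs_nonneg _) (mul_nonneg hA.1 (Real.exp_pos _).le)
      _ = c₁ * c₂ * Real.exp (-(δa * dX (pa a) (pb b)) + -(δb * dX (pb b) (pc c))) := by
          rw [Real.exp_add]; ring
      _ ≤ c₁ * c₂ * Real.exp (-(δ' * dX (pa a) (pc c)) + -(g * dX (pa a) (pb b))) := by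
          apply mul_le_mul_of_nonneg_left _ (mul_nonneg hA.1 hB.1)
          apply Real.exp_le_exp.mpr
          have h1 : (δ' + g) * dX (pa a) (pb b) ≤ δa * dX (pa a) (pb b) :=
            mul_le_mul_of_nonneg_right hga hab
          have h2 : (δ' + g) * dX (pb b) (pc c) ≤ δb * dX (pb b) (pc c) :=
            mul_le_mul_of_nonneg_right hgb hbc
          have h3 : δ' * dX (pa a) (pc c) ≤ δ' * (dX (pa a) (pb b) + dX (pb b) (pc c)) :=
            mul_le_mul_of_nonneg_left htri hδ'
          nlinarith [mul_nonneg hg.le hbc]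
      _ = c₁ * c₂ * Real.exp (-(δ' * dX (pa a) (pc c))) * Real.exp (-(g * dX (pa a) (pb b))) := by
          rw [Real.exp_add]; ring
  calc |∑ b, A a b * B b c| ≤ ∑ b, |A a b * B b c| := Finset.abs_sum_le_sum_abs _ _
    _ ≤ ∑ b, c₁ * c₂ * Real.exp (-(δ' * dX (pa a) (pc c))) * Real.exp (-(g * dX (pa a) (pb b))) :=
        Finset.sum_le_sum fun b _ => key b
    _ = c₁ * c₂ * Real.exp (-(δ' * dX (pa a) (pc c))) * ∑ b, Real.exp (-(g * dX (pa a) (pb b))) := by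
        rw [Finset.mul_sum]
    _ ≤ c₁ * c₂ * Real.exp (-(δ' * dX (pa a) (pc c))) * K g :=
        mul_le_mul_of_nonneg_left (hK g hg (pa a))
          (mul_nonneg (mul_nonneg hA.1 hB.1) (Real.exp_pos _).le)
    _ = c₁ * c₂ * K g * Real.exp (-(δ' * dX (pa a) (pc c))) := by ring

/-- **The finite "analyticity method"**: a coercive (`γ₀ ≤ S`, `γ₀ > 0`) kernel on a positioned family with profile
`K`, decaying at rate `δ₀ > 0` with constant `c₀`, has an inverse decaying at the rate
`δ₁ = B4Sect5Torus.rate K γ₀ c₀ δ₀ > 0` with constant `2/γ₀` — the tree's finite Combes–Thomas bound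
`QGQInverse.inverse_decay` fed with the weighted Schur sums of `B4Sect5Torus` (as in `B4Sect5Torus.inv_decay`, without
its symmetry conjunct). [folklore] -/
theorem PosDecay.inv {κ : Type*} [Fintype κ] [DecidableEq κ] (hd : IsPseudoDist dX) {σ : κ → X} {K : ℝ → ℝ}
    (hK0 : ∀ t, 0 < t → 0 ≤ K t) (hK : PosProfile dX σ K) {S : Matrix κ κ ℝ} {γ₀ c₀ δ₀ : ℝ}
    (hγ : 0 < γ₀) (hδ : 0 < δ₀) (hS : PosDecay dX σ σ S c₀ δ₀) (hco : QGQInverse.Coercive S γ₀) :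
    PosDecay dX σ σ S⁻¹ (2 / γ₀) (rate K γ₀ c₀ δ₀) := by
  have hρ : IsPseudoDist (fun y y' : κ => dX (σ y) (σ y')) := hd.comp σ
  have hSB : SumBound (fun y y' : κ => dX (σ y) (σ y')) K := hK.sumBound
  refine ⟨by positivity, fun p q => ?_⟩
  have hδ₁0 : 0 ≤ rate K γ₀ c₀ δ₀ := (B4Sect5Torus.rate_pos hK0 hγ hS.1 hδ).le
  have hδ₁4 : rate K γ₀ c₀ δ₀ ≤ δ₀ / 4 := B4Sect5Torus.rate_le_quarter K γ₀ c₀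
  have hrle : rate K γ₀ c₀ δ₀ * weightC K c₀ δ₀ ≤ γ₀ / 2 := B4Sect5Torus.rate_mul_weightC_le hK0 hγ hS.1 hδ
  have hrγ : rate K γ₀ c₀ δ₀ * weightC K c₀ δ₀ < γ₀ := by linarith
  have h := QGQInverse.inverse_decay S (fun y y' : κ => dX (σ y) (σ y')) hrγ hδ₁0 hco hρ.symm hρ.zero
    hρ.triangle
    (fun i => B4Sect5Torus.weightedRowSum_le hρ.nonneg hSB S hS.1 hδ hδ₁0 hδ₁4 hS.2 i)
    (fun j => B4Sect5Torus.weightedColSum_le hρ hSB S hS.1 hδ hδ₁0 hδ₁4 hS.2 j) p q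
  refine h.trans ?_
  apply mul_le_mul_of_nonneg_right _ (Real.exp_pos _).le
  rw [div_eq_mul_inv, show (2 : ℝ) * γ₀⁻¹ = (γ₀ / 2)⁻¹ by rw [inv_div]; ring]
  exact inv_anti₀ (by linarith) (by linarith)

/-- The `∃ δ′₀ > 0, ∃ C > 0` shape of (1.126) from a positioned decay at a positive rate. [folklore] -/
theorem PosDecay.shape {pa : α → X} {A : Matrix α α ℝ} {c δ : ℝ} (h : PosDecay dX pa pa A c δ) (hδ : 0 < δ) :
    ∃ δ₀' C : ℝ, 0 < δ₀' ∧ 0 < C ∧ ∀ a b, |A a b| ≤ C * Real.exp (-(δ₀' * dX (pa a) (pa b))) :=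
  ⟨δ, c + 1, hδ, by linarith [h.1], fun a b =>
    (h.2 a b).trans (mul_le_mul_of_nonneg_right (by linarith) (Real.exp_pos _).le)⟩

/-- **Difference of two rows through a decaying kernel** (the mechanism of (1.127)): if the rows `x, x′` of
`E : α×β` differ entrywise by at most `h·e^{−δa·dX(pa x, pb b)}` and `R : β×γ` decays (rate `δb`, constant `c₂`), then
the rows `x, x′` of `E·R` differ by at most `h·c₂·K(g)·e^{−δ′·dX(pa x, pc c)}` (`PosDecay.mul` for the one-row kernel
`b ↦ E(x,b) − E(x′,b)`). [folklore] -/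
theorem PosDecay.row_diff [Fintype β] (hd : IsPseudoDist dX) {pa : α → X} {pb : β → X} {pc : γ → X}
    {K : ℝ → ℝ} (hK0 : ∀ t, 0 < t → 0 ≤ K t) (hK : PosProfile dX pb K)
    {E : Matrix α β ℝ} {R : Matrix β γ ℝ} {c₂ δa δb : ℝ} (hR : PosDecay dX pb pc R c₂ δb)
    {x x' : α} {h : ℝ} (hh : 0 ≤ h)
    (hE : ∀ b, |E x b - E x' b| ≤ h * Real.exp (-(δa * dX (pa x) (pb b))))
    {δ' g : ℝ} (hδ' : 0 ≤ δ') (hg : 0 < g) (hga : δ' + g ≤ δa) (hgb : δ' + g ≤ δb) (c : γ) :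
    |(E * R) x c - (E * R) x' c| ≤ h * c₂ * K g * Real.exp (-(δ' * dX (pa x) (pc c))) := by
  set A : Matrix Unit β ℝ := fun _ b => E x b - E x' b with hA_def
  have hA : PosDecay dX (fun _ : Unit => pa x) pb A h δa := ⟨hh, fun _ b => hE b⟩
  have hmul := (PosDecay.mul hd hK0 hK hA hR hδ' hg hga hgb).2 () c
  have heq : (A * R) () c = (E * R) x c - (E * R) x' c := by
    simp only [Matrix.mul_apply, hA_def, sub_mul, Finset.sum_sub_distrib]
  rw [heq] at hmul
  exact hmul

end Positioned

/-! ## §2  The decay (1.126) of `∂P∂*`, `P = G′Q′*(Q′G′²Q′*)⁻¹Q′G′`, from its constituents -/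

section Assembly

variable {X : Type*} {dX : X → X → ℝ}
variable {ι κ : Type*} [Fintype ι] [Fintype κ] [DecidableEq κ]

/-- The constant of `M = Q′G′²Q′*` produced by three compositions (rates `δ → δ/2 → δ/4 → δ/8`). [folklore] -/
def cM126 (K₁ : ℝ → ℝ) (cG cB cBst δ : ℝ) : ℝ :=
  cB * cG * K₁ (δ / 2) * cG * K₁ (δ / 4) * cBst * K₁ (δ / 8)

/-- The decay rate of `M⁻¹ = (Q′G′²Q′*)⁻¹` (Combes–Thomas rate for constant `cM126`, input rate `δ/8`). [folklore] -/
def rInv126 (K₁ K₂ : ℝ → ℝ) (cG cB cBst γ₀ δ : ℝ) : ℝ :=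
  rate K₂ γ₀ (cM126 K₁ cG cB cBst δ) (δ / 8)

/-- The rate `δ′₀` of (1.126) produced by the chain: `rInv126 / 64` (six further compositions). [folklore] -/
def rate126 (K₁ K₂ : ℝ → ℝ) (cG cB cBst γ₀ δ : ℝ) : ℝ :=
  rInv126 K₁ K₂ cG cB cBst γ₀ δ / 64

/-- The constant `O(1)` of (1.126) produced by the chain `D·G·Q′*·M⁻¹·Q′·G·D′`. [folklore] -/
def const126 (K₁ K₂ : ℝ → ℝ) (cD cD' cG cB cBst γ₀ δ : ℝ) : ℝ :=
  cD * cG * K₁ (rInv126 K₁ K₂ cG cB cBst γ₀ δ / 2) * cBst * K₁ (rInv126 K₁ K₂ cG cB cBst γ₀ δ / 4)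
    * (2 / γ₀) * K₂ (rInv126 K₁ K₂ cG cB cBst γ₀ δ / 8) * cB * K₂ (rInv126 K₁ K₂ cG cB cBst γ₀ δ / 16)
    * cG * K₁ (rInv126 K₁ K₂ cG cB cBst γ₀ δ / 32) * cD' * K₁ (rInv126 K₁ K₂ cG cB cBst γ₀ δ / 64)

omit [Fintype κ] [DecidableEq κ] in
/-- `M = Q′G′²Q′*` decays: rate `δ/8`, constant `cM126`. [folklore] -/
theorem decay_M (hd : IsPseudoDist dX) {π : ι → X} {σ : κ → X} {K₁ : ℝ → ℝ}
    (hK₁0 : ∀ t, 0 < t → 0 ≤ K₁ t) (hK₁ : PosProfile dX π K₁)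
    {G : Matrix ι ι ℝ} {B : Matrix κ ι ℝ} {Bst : Matrix ι κ ℝ} {cG cB cBst δ : ℝ} (hδ : 0 < δ)
    (hG : PosDecay dX π π G cG δ) (hB : PosDecay dX σ π B cB δ) (hBst : PosDecay dX π σ Bst cBst δ) :
    PosDecay dX σ σ (B * G * G * Bst) (cM126 K₁ cG cB cBst δ) (δ / 8) := by
  have h1 : PosDecay dX σ π (B * G) (cB * cG * K₁ (δ / 2)) (δ / 2) :=
    PosDecay.mul hd hK₁0 hK₁ hB hG (by linarith) (by linarith) (by linarith) (by linarith)
  have h2 : PosDecay dX σ π (B * G * G) (cB * cG * K₁ (δ / 2) * cG * K₁ (δ / 4)) (δ / 4) :=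
    PosDecay.mul hd hK₁0 hK₁ h1 hG (by linarith) (by linarith) (by linarith) (by linarith)
  exact PosDecay.mul hd hK₁0 hK₁ h2 hBst (by linarith) (by linarith) (by linarith) (by linarith)

/-- The Combes–Thomas rate of `M⁻¹` is positive. [folklore] -/
theorem rInv126_pos {K₁ K₂ : ℝ → ℝ} (hK₁0 : ∀ t, 0 < t → 0 ≤ K₁ t) (hK₂0 : ∀ t, 0 < t → 0 ≤ K₂ t)
    {cG cB cBst γ₀ δ : ℝ} (hcG : 0 ≤ cG) (hcB : 0 ≤ cB) (hcBst : 0 ≤ cBst) (hγ : 0 < γ₀) (hδ : 0 < δ) :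
    0 < rInv126 K₁ K₂ cG cB cBst γ₀ δ := by
  unfold rInv126
  apply B4Sect5Torus.rate_pos hK₂0 hγ _ (by linarith)
  unfold cM126
  have := hK₁0 (δ / 2) (by linarith)
  have := hK₁0 (δ / 4) (by linarith)
  have := hK₁0 (δ / 8) (by linarith)
  positivity

/-- `0 < rate126`. [folklore] -/
theorem rate126_pos {K₁ K₂ : ℝ → ℝ} (hK₁0 : ∀ t, 0 < t → 0 ≤ K₁ t) (hK₂0 : ∀ t, 0 < t → 0 ≤ K₂ t)
    {cG cB cBst γ₀ δ : ℝ} (hcG : 0 ≤ cG) (hcB : 0 ≤ cB) (hcBst : 0 ≤ cBst) (hγ : 0 < γ₀) (hδ : 0 < δ) :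
    0 < rate126 K₁ K₂ cG cB cBst γ₀ δ := by
  unfold rate126
  exact div_pos (rInv126_pos hK₁0 hK₂0 hcG hcB hcBst hγ hδ) (by norm_num)

/-- **(1.126) from its constituents** (the p. 38 sentence, by type).  Let `G, D, D′ : ι×ι`, `B : κ×ι`, `B⋆ : ι×κ` be
positioned kernels decaying at a common rate `δ > 0` (read: `G′` by Theorem 1 / Lemma 2.4 of [2]; `∂_μ`, `∂*_ν`,
`Q′`, `Q′*` finite range, `PosDecay.of_finiteRange`), the families `π, σ` having profiles `K₁, K₂`, and let
`M := B·G·G·B⋆` be coercive with constant `γ₀ > 0` (read: *"γ₀ ≤ Q′_kG′_k²Q′*_k"*, p. 26, the invertibility asked for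
on p. 25).  Then the kernel of `D·G·B⋆·M⁻¹·B·G·D′` (read `∂_μ P ∂*_ν`, `P = G′Q′*(Q′G′²Q′*)⁻¹Q′G′`) decays:
`|·(x,x′)| ≤ const126·e^{−rate126·dX(πx,πx′)}`.  HYPOTHESES `hG, hD, hD', hB, hBst` = (α), `hM` = (β) of cell GAPS
G-B5-34; nothing of [2] is proved here. [cite: Balaban1984PropagatorsI, (1.126) p.38] -/
theorem decay126 (hd : IsPseudoDist dX) {π : ι → X} {σ : κ → X} {K₁ K₂ : ℝ → ℝ}
    (hK₁0 : ∀ t, 0 < t → 0 ≤ K₁ t) (hK₁ : PosProfile dX π K₁)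
    (hK₂0 : ∀ t, 0 < t → 0 ≤ K₂ t) (hK₂ : PosProfile dX σ K₂)
    {G D D' : Matrix ι ι ℝ} {B : Matrix κ ι ℝ} {Bst : Matrix ι κ ℝ} {cG cD cD' cB cBst δ γ₀ : ℝ}
    (hδ : 0 < δ) (hγ : 0 < γ₀)
    (hG : PosDecay dX π π G cG δ) (hD : PosDecay dX π π D cD δ) (hD' : PosDecay dX π π D' cD' δ)
    (hB : PosDecay dX σ π B cB δ) (hBst : PosDecay dX π σ Bst cBst δ)
    (hM : QGQInverse.Coercive (B * G * G * Bst) γ₀) :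
    PosDecay dX π π (D * G * Bst * (B * G * G * Bst)⁻¹ * B * G * D')
      (const126 K₁ K₂ cD cD' cG cB cBst γ₀ δ) (rate126 K₁ K₂ cG cB cBst γ₀ δ) := by
  have hMdec := decay_M hd hK₁0 hK₁ hδ hG hB hBst
  have hInv : PosDecay dX σ σ (B * G * G * Bst)⁻¹ (2 / γ₀) (rInv126 K₁ K₂ cG cB cBst γ₀ δ) :=
    PosDecay.inv hd hK₂0 hK₂ hγ (by linarith) hMdec hM
  have hr : 0 < rInv126 K₁ K₂ cG cB cBst γ₀ δ := rInv126_pos hK₁0 hK₂0 hG.1 hB.1 hBst.1 hγ hδ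
  have hrδ : rInv126 K₁ K₂ cG cB cBst γ₀ δ ≤ δ := by
    have h4 : rInv126 K₁ K₂ cG cB cBst γ₀ δ ≤ δ / 8 / 4 :=
      B4Sect5Torus.rate_le_quarter K₂ γ₀ (cM126 K₁ cG cB cBst δ)
    linarith
  set r := rInv126 K₁ K₂ cG cB cBst γ₀ δ with hr_def
  have f1 : PosDecay dX π π (D * G) (cD * cG * K₁ (r / 2)) (r / 2) :=
    PosDecay.mul hd hK₁0 hK₁ hD hG (by linarith) (by linarith) (by linarith) (by linarith)
  have f2 : PosDecay dX π σ (D * G * Bst) (cD * cG * K₁ (r / 2) * cBst * K₁ (r / 4)) (r / 4) :=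
    PosDecay.mul hd hK₁0 hK₁ f1 hBst (by linarith) (by linarith) (by linarith) (by linarith)
  have f3 : PosDecay dX π σ (D * G * Bst * (B * G * G * Bst)⁻¹)
      (cD * cG * K₁ (r / 2) * cBst * K₁ (r / 4) * (2 / γ₀) * K₂ (r / 8)) (r / 8) :=
    PosDecay.mul hd hK₂0 hK₂ f2 hInv (by linarith) (by linarith) (by linarith) (by linarith)
  have f4 : PosDecay dX π π (D * G * Bst * (B * G * G * Bst)⁻¹ * B)
      (cD * cG * K₁ (r / 2) * cBst * K₁ (r / 4) * (2 / γ₀) * K₂ (r / 8) * cB * K₂ (r / 16)) (r / 16) :=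
    PosDecay.mul hd hK₂0 hK₂ f3 hB (by linarith) (by linarith) (by linarith) (by linarith)
  have f5 : PosDecay dX π π (D * G * Bst * (B * G * G * Bst)⁻¹ * B * G)
      (cD * cG * K₁ (r / 2) * cBst * K₁ (r / 4) * (2 / γ₀) * K₂ (r / 8) * cB * K₂ (r / 16) * cG
        * K₁ (r / 32)) (r / 32) :=
    PosDecay.mul hd hK₁0 hK₁ f4 hG (by linarith) (by linarith) (by linarith) (by linarith)
  have f6 : PosDecay dX π π (D * G * Bst * (B * G * G * Bst)⁻¹ * B * G * D')
      (cD * cG * K₁ (r / 2) * cBst * K₁ (r / 4) * (2 / γ₀) * K₂ (r / 8) * cB * K₂ (r / 16) * cG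
        * K₁ (r / 32) * cD' * K₁ (r / 64)) (r / 64) :=
    PosDecay.mul hd hK₁0 hK₁ f5 hD' (by linarith) (by linarith) (by linarith) (by linarith)
  simpa only [const126, rate126, hr_def] using f6

/-- **(1.126) in the printed shape** `∃ δ′₀ > 0, ∃ O(1) > 0, |(∂P∂*)(x,x′)| ≤ O(1)e^{−δ′₀|x−x′|}` (the first conjunct
of the tree's leaf `B5.Kernel126_127Printed` for one kernel), from the hypotheses of `decay126`.
[cite: Balaban1984PropagatorsI, (1.126) p.38] -/
theorem decay126_shape (hd : IsPseudoDist dX) {π : ι → X} {σ : κ → X} {K₁ K₂ : ℝ → ℝ}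
    (hK₁0 : ∀ t, 0 < t → 0 ≤ K₁ t) (hK₁ : PosProfile dX π K₁)
    (hK₂0 : ∀ t, 0 < t → 0 ≤ K₂ t) (hK₂ : PosProfile dX σ K₂)
    {G D D' : Matrix ι ι ℝ} {B : Matrix κ ι ℝ} {Bst : Matrix ι κ ℝ} {cG cD cD' cB cBst δ γ₀ : ℝ}
    (hδ : 0 < δ) (hγ : 0 < γ₀)
    (hG : PosDecay dX π π G cG δ) (hD : PosDecay dX π π D cD δ) (hD' : PosDecay dX π π D' cD' δ)
    (hB : PosDecay dX σ π B cB δ) (hBst : PosDecay dX π σ Bst cBst δ)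
    (hM : QGQInverse.Coercive (B * G * G * Bst) γ₀) :
    ∃ δ₀' C : ℝ, 0 < δ₀' ∧ 0 < C ∧ ∀ x x',
      |(D * G * Bst * (B * G * G * Bst)⁻¹ * B * G * D') x x'| ≤ C * Real.exp (-(δ₀' * dX (π x) (π x'))) :=
  (decay126 hd hK₁0 hK₁ hK₂0 hK₂ hδ hγ hG hD hD' hB hBst hM).shape
    (rate126_pos hK₁0 hK₂0 hG.1 hB.1 hBst.1 hγ hδ)

/-- The constant of the right factor `Q′*·M⁻¹·Q′·G·D′` of `∂P∂*` times the last profile, for (1.127). [folklore] -/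
def const127 (K₁ K₂ : ℝ → ℝ) (cD' cG cB cBst γ₀ δ : ℝ) : ℝ :=
  cBst * (2 / γ₀ * (cB * (cG * cD' * K₁ (rInv126 K₁ K₂ cG cB cBst γ₀ δ / 2))
    * K₁ (rInv126 K₁ K₂ cG cB cBst γ₀ δ / 4)) * K₂ (rInv126 K₁ K₂ cG cB cBst γ₀ δ / 8))
    * K₂ (rInv126 K₁ K₂ cG cB cBst γ₀ δ / 16) * K₁ (rInv126 K₁ K₂ cG cB cBst γ₀ δ / 64)

/-- **(1.127) from its constituents** (the Hölder half of the p. 38 sentence, by type): under the hypotheses of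
`decay126`, if two rows `x, x′` of `∂G′ = D·G` differ entrywise by at most `h·e^{−δ·dX(πx, πb)}` (read: the Hölder
continuity of `∇G′` of Theorem 1 / Lemma 2.4 of [2] with `h = O(1)|x − x′|^α`, HYPOTHESIS (α′) of cell GAPS G-B5-34),
then the rows `x, x′` of `∂P∂*` differ by at most `h·const127·e^{−rate126·dX(πx, πx″)}`.
[cite: Balaban1984PropagatorsI, (1.127) p.38] -/
theorem holder127 (hd : IsPseudoDist dX) {π : ι → X} {σ : κ → X} {K₁ K₂ : ℝ → ℝ}
    (hK₁0 : ∀ t, 0 < t → 0 ≤ K₁ t) (hK₁ : PosProfile dX π K₁)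
    (hK₂0 : ∀ t, 0 < t → 0 ≤ K₂ t) (hK₂ : PosProfile dX σ K₂)
    {G D D' : Matrix ι ι ℝ} {B : Matrix κ ι ℝ} {Bst : Matrix ι κ ℝ} {cG cD' cB cBst δ γ₀ : ℝ}
    (hδ : 0 < δ) (hγ : 0 < γ₀)
    (hG : PosDecay dX π π G cG δ) (hD' : PosDecay dX π π D' cD' δ)
    (hB : PosDecay dX σ π B cB δ) (hBst : PosDecay dX π σ Bst cBst δ)
    (hM : QGQInverse.Coercive (B * G * G * Bst) γ₀)
    {x x' : ι} {h : ℝ} (hh : 0 ≤ h)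
    (hE : ∀ b, |(D * G) x b - (D * G) x' b| ≤ h * Real.exp (-(δ * dX (π x) (π b)))) (x'' : ι) :
    |(D * G * Bst * (B * G * G * Bst)⁻¹ * B * G * D') x x''
        - (D * G * Bst * (B * G * G * Bst)⁻¹ * B * G * D') x' x''|
      ≤ h * const127 K₁ K₂ cD' cG cB cBst γ₀ δ
          * Real.exp (-(rate126 K₁ K₂ cG cB cBst γ₀ δ * dX (π x) (π x''))) := by
  have hMdec := decay_M hd hK₁0 hK₁ hδ hG hB hBst
  have hInv : PosDecay dX σ σ (B * G * G * Bst)⁻¹ (2 / γ₀) (rInv126 K₁ K₂ cG cB cBst γ₀ δ) :=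
    PosDecay.inv hd hK₂0 hK₂ hγ (by linarith) hMdec hM
  have hr : 0 < rInv126 K₁ K₂ cG cB cBst γ₀ δ := rInv126_pos hK₁0 hK₂0 hG.1 hB.1 hBst.1 hγ hδ
  have hrδ : rInv126 K₁ K₂ cG cB cBst γ₀ δ ≤ δ := by
    have h4 : rInv126 K₁ K₂ cG cB cBst γ₀ δ ≤ δ / 8 / 4 :=
      B4Sect5Torus.rate_le_quarter K₂ γ₀ (cM126 K₁ cG cB cBst δ)
    linarith
  set r := rInv126 K₁ K₂ cG cB cBst γ₀ δ with hr_def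
  have g1 : PosDecay dX π π (G * D') (cG * cD' * K₁ (r / 2)) (r / 2) :=
    PosDecay.mul hd hK₁0 hK₁ hG hD' (by linarith) (by linarith) (by linarith) (by linarith)
  have g2 : PosDecay dX σ π (B * (G * D')) (cB * (cG * cD' * K₁ (r / 2)) * K₁ (r / 4)) (r / 4) :=
    PosDecay.mul hd hK₁0 hK₁ hB g1 (by linarith) (by linarith) (by linarith) (by linarith)
  have g3 : PosDecay dX σ π ((B * G * G * Bst)⁻¹ * (B * (G * D')))
      (2 / γ₀ * (cB * (cG * cD' * K₁ (r / 2)) * K₁ (r / 4)) * K₂ (r / 8)) (r / 8) :=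
    PosDecay.mul hd hK₂0 hK₂ hInv g2 (by linarith) (by linarith) (by linarith) (by linarith)
  have g4 : PosDecay dX π π (Bst * ((B * G * G * Bst)⁻¹ * (B * (G * D'))))
      (cBst * (2 / γ₀ * (cB * (cG * cD' * K₁ (r / 2)) * K₁ (r / 4)) * K₂ (r / 8)) * K₂ (r / 16)) (r / 16) :=
    PosDecay.mul hd hK₂0 hK₂ hBst g3 (by linarith) (by linarith) (by linarith) (by linarith)
  have hassoc : D * G * Bst * (B * G * G * Bst)⁻¹ * B * G * D'
      = D * G * (Bst * ((B * G * G * Bst)⁻¹ * (B * (G * D')))) := by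
    simp only [Matrix.mul_assoc]
  have hrow := PosDecay.row_diff hd hK₁0 hK₁ g4 hh hE (δ' := r / 64) (g := r / 64)
    (by linarith) (by linarith) (by linarith) (by linarith) x''
  rw [hassoc]
  simpa only [const127, rate126, hr_def, mul_assoc] using hrow

/-- **The leaf (1.126)–(1.127) in its printed shape** (`B5.Kernel126_127Printed`, for the family of kernels
`(μ,ν) ↦ (∂_μP∂*_ν)(x,x′)` on a carrier of sites `X` with components `X × Fin m`, `π = Prod.fst`), DERIVED from the typed
constituents: (α) decay of `G, D, D′, Q′, Q′*`; (α′) Hölder rows of `D·G` for EVERY exponent `α < 1` with constant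
`CH α ≥ 0` (read: Theorem 1 of [2]); (β) coercivity of `Q′G′²Q′*`.  Nothing of [2] is proved here.
[cite: Balaban1984PropagatorsI, (1.126)–(1.127) p.38] -/
theorem kernel126_127_of_constituents {X : Type} {dX : X → X → ℝ} [Fintype X] {m : ℕ}
    {κ : Type*} [Fintype κ] [DecidableEq κ] (hd : IsPseudoDist dX) {σ : κ → X} {K₁ K₂ : ℝ → ℝ}
    (hK₁0 : ∀ t, 0 < t → 0 ≤ K₁ t) (hK₁ : PosProfile dX (Prod.fst : X × Fin m → X) K₁)
    (hK₂0 : ∀ t, 0 < t → 0 ≤ K₂ t) (hK₂ : PosProfile dX σ K₂)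
    {G D D' : Matrix (X × Fin m) (X × Fin m) ℝ} {B : Matrix κ (X × Fin m) ℝ} {Bst : Matrix (X × Fin m) κ ℝ}
    {cG cD cD' cB cBst δ γ₀ : ℝ} (hδ : 0 < δ) (hγ : 0 < γ₀)
    (hG : PosDecay dX Prod.fst Prod.fst G cG δ) (hD : PosDecay dX Prod.fst Prod.fst D cD δ)
    (hD' : PosDecay dX Prod.fst Prod.fst D' cD' δ)
    (hB : PosDecay dX σ Prod.fst B cB δ) (hBst : PosDecay dX Prod.fst σ Bst cBst δ)
    (hM : QGQInverse.Coercive (B * G * G * Bst) γ₀)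
    {CH : ℝ → ℝ} (hCH : ∀ α, α < 1 → 0 ≤ CH α)
    (hH : ∀ α : ℝ, α < 1 → ∀ (μ : Fin m) (x x' : X), dX x x' ≤ 1 → ∀ b : X × Fin m,
      |(D * G) (x, μ) b - (D * G) (x', μ) b| ≤ CH α * dX x x' ^ α * Real.exp (-(δ * dX x b.1))) :
    B5.Kernel126_127Printed (fun p : Fin m × Fin m =>
      (⟨X, dX, fun x x' => (D * G * Bst * (B * G * G * Bst)⁻¹ * B * G * D') (x, p.1) (x', p.2)⟩ :
        B5.KernelData)) := by
  have hdec := decay126 hd hK₁0 hK₁ hK₂0 hK₂ hδ hγ hG hD hD' hB hBst hM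
  refine ⟨rate126 K₁ K₂ cG cB cBst γ₀ δ, const126 K₁ K₂ cD cD' cG cB cBst γ₀ δ + 1,
    fun α => CH α * const127 K₁ K₂ cD' cG cB cBst γ₀ δ,
    rate126_pos hK₁0 hK₂0 hG.1 hB.1 hBst.1 hγ hδ, by linarith [hdec.1], fun p => ⟨?_, ?_⟩⟩
  · intro x x'
    exact (hdec.2 (x, p.1) (x', p.2)).trans
      (mul_le_mul_of_nonneg_right (by linarith) (Real.exp_pos _).le)
  · intro α x x' x'' hα hxx'
    have hh : 0 ≤ CH α * dX x x' ^ α :=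
      mul_nonneg (hCH α hα) (Real.rpow_nonneg (hd.nonneg x x') α)
    have hrow := holder127 hd hK₁0 hK₁ hK₂0 hK₂ hδ hγ hG hD' hB hBst hM hh
      (x := (x, p.1)) (x' := (x', p.1)) (fun b => hH α hα p.1 x x' hxx' b) (x'', p.2)
    calc _ ≤ _ := hrow
      _ = _ := by ring

/-! ### §2b. The same algebra with the DECAY OF THE INVERSE as input (no coercivity) -/

/-- The constant of (1.126) when the kernel decay of `Mi = (Q′G′²Q′*)⁻¹` is an INPUT (constant `cMi`, rate `δ`). [folklore] -/
def const126i (K₁ K₂ : ℝ → ℝ) (cD cD' cG cB cBst cMi δ : ℝ) : ℝ :=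
  cD * cG * K₁ (δ / 2) * cBst * K₁ (δ / 4) * cMi * K₂ (δ / 8) * cB * K₂ (δ / 16) * cG * K₁ (δ / 32) * cD'
    * K₁ (δ / 64)

omit [DecidableEq κ] in
/-- **(1.126) from its constituents, variant**: the p. 38 sentence names, besides Lemma 2.4 of [2], *"the representation
(1.45) and the analyticity method of proving an exponential decay"* — i.e. the exponential decay of the KERNEL of
`(Q′G′²Q′*)⁻¹` (the inverse of the operator `Q′G′²Q′*`, of which p. 25 prints «It is a translation invariant operator on the
unit lattice T₁^{(k)}»; the inverse is then translation invariant too).  Taking THAT decay as the input for the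
middle factor (here an arbitrary coarse×coarse kernel `Mi` with `|Mi b b′| ≤ cMi·e^{−δ·dX}` — read `Mi = (Q′G′²Q′*)⁻¹`;
the tree holds a kernel certificate of this decay in the multiplier model, `B5Torus145Decay.inverse145_torusKernelM_decay_torusMetric`),
the kernel `D·G·Q′*·Mi·Q′·G·D′` decays at rate `δ/64` with the explicit constant `const126i` — six applications of
`PosDecay.mul`, no coercivity, no inverse. [cite: Balaban1984PropagatorsI, (1.126) p.38, p.25 l.35–36]
-/
theorem decay126_of_inv (hd : IsPseudoDist dX) {π : ι → X} {σ : κ → X} {K₁ K₂ : ℝ → ℝ}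
    (hK₁0 : ∀ t, 0 < t → 0 ≤ K₁ t) (hK₁ : PosProfile dX π K₁)
    (hK₂0 : ∀ t, 0 < t → 0 ≤ K₂ t) (hK₂ : PosProfile dX σ K₂)
    {G D D' : Matrix ι ι ℝ} {B : Matrix κ ι ℝ} {Bst : Matrix ι κ ℝ} {Mi : Matrix κ κ ℝ}
    {cG cD cD' cB cBst cMi δ : ℝ} (hδ : 0 < δ)
    (hG : PosDecay dX π π G cG δ) (hD : PosDecay dX π π D cD δ) (hD' : PosDecay dX π π D' cD' δ)
    (hB : PosDecay dX σ π B cB δ) (hBst : PosDecay dX π σ Bst cBst δ) (hMi : PosDecay dX σ σ Mi cMi δ) :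
    PosDecay dX π π (D * G * Bst * Mi * B * G * D') (const126i K₁ K₂ cD cD' cG cB cBst cMi δ) (δ / 64) := by
  have f1 : PosDecay dX π π (D * G) (cD * cG * K₁ (δ / 2)) (δ / 2) :=
    PosDecay.mul hd hK₁0 hK₁ hD hG (by linarith) (by linarith) (by linarith) (by linarith)
  have f2 : PosDecay dX π σ (D * G * Bst) (cD * cG * K₁ (δ / 2) * cBst * K₁ (δ / 4)) (δ / 4) :=
    PosDecay.mul hd hK₁0 hK₁ f1 hBst (by linarith) (by linarith) (by linarith) (by linarith)
  have f3 : PosDecay dX π σ (D * G * Bst * Mi)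
      (cD * cG * K₁ (δ / 2) * cBst * K₁ (δ / 4) * cMi * K₂ (δ / 8)) (δ / 8) :=
    PosDecay.mul hd hK₂0 hK₂ f2 hMi (by linarith) (by linarith) (by linarith) (by linarith)
  have f4 : PosDecay dX π π (D * G * Bst * Mi * B)
      (cD * cG * K₁ (δ / 2) * cBst * K₁ (δ / 4) * cMi * K₂ (δ / 8) * cB * K₂ (δ / 16)) (δ / 16) :=
    PosDecay.mul hd hK₂0 hK₂ f3 hB (by linarith) (by linarith) (by linarith) (by linarith)
  have f5 : PosDecay dX π π (D * G * Bst * Mi * B * G)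
      (cD * cG * K₁ (δ / 2) * cBst * K₁ (δ / 4) * cMi * K₂ (δ / 8) * cB * K₂ (δ / 16) * cG * K₁ (δ / 32))
      (δ / 32) :=
    PosDecay.mul hd hK₁0 hK₁ f4 hG (by linarith) (by linarith) (by linarith) (by linarith)
  exact PosDecay.mul hd hK₁0 hK₁ f5 hD' (by linarith) (by linarith) (by linarith) (by linarith)

omit [DecidableEq κ] in
/-- (1.126) in the printed `∃ δ′₀ > 0, ∃ O(1) > 0` shape from the variant hypotheses. [cite: Balaban1984PropagatorsI, (1.126) p.38] -/
theorem decay126_of_inv_shape (hd : IsPseudoDist dX) {π : ι → X} {σ : κ → X} {K₁ K₂ : ℝ → ℝ}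
    (hK₁0 : ∀ t, 0 < t → 0 ≤ K₁ t) (hK₁ : PosProfile dX π K₁)
    (hK₂0 : ∀ t, 0 < t → 0 ≤ K₂ t) (hK₂ : PosProfile dX σ K₂)
    {G D D' : Matrix ι ι ℝ} {B : Matrix κ ι ℝ} {Bst : Matrix ι κ ℝ} {Mi : Matrix κ κ ℝ}
    {cG cD cD' cB cBst cMi δ : ℝ} (hδ : 0 < δ)
    (hG : PosDecay dX π π G cG δ) (hD : PosDecay dX π π D cD δ) (hD' : PosDecay dX π π D' cD' δ)
    (hB : PosDecay dX σ π B cB δ) (hBst : PosDecay dX π σ Bst cBst δ) (hMi : PosDecay dX σ σ Mi cMi δ) :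
    ∃ δ₀' C : ℝ, 0 < δ₀' ∧ 0 < C ∧ ∀ x x',
      |(D * G * Bst * Mi * B * G * D') x x'| ≤ C * Real.exp (-(δ₀' * dX (π x) (π x'))) :=
  (decay126_of_inv hd hK₁0 hK₁ hK₂0 hK₂ hδ hG hD hD' hB hBst hMi).shape (by linarith)

end Assembly

/-! ## §3  The profiles of the torus averaging model -/

section Torus

variable {d : ℕ} {N : Fin d → ℕ} [∀ i, NeZero (N i)]

/-- The torus distance of `UT N` is a pseudo-distance in the sense of `B4Sect5Torus`. [folklore] -/
theorem isPseudoDist_torusDist : IsPseudoDist (fun x y : UT N => dist x y) :=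
  ⟨fun x y => dist_comm x y, fun x => dist_self x, fun x y z => dist_triangle x y z⟩

/-- **Torus profile of a positioned family with bounded fibres**: if every site of `UT N` carries at most `m` members
of the family `pb`, then `Σ_b e^{−t·dist(x, pb b)} ≤ m·K_d(t)` for every `x ∈ UT N` and `t > 0`, uniformly in the
periods (`B4Sect5Torus.torusSum_le`, constant `B4Sect5Proof.latticeConst`). [folklore] -/
theorem posProfile_torus {β : Type*} [Fintype β] (pb : β → UT N) {m : ℕ}
    (hm : ∀ y : UT N, ((Finset.univ.filter fun b : β => pb b = y).card : ℝ) ≤ m) :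
    PosProfile (fun x y : UT N => dist x y) pb (fun t => m * B4Sect5Proof.latticeConst d t) := by
  classical
  intro t ht x
  have hfib : ∑ b, Real.exp (-(t * dist x (pb b)))
      = ∑ y : UT N, ∑ b ∈ Finset.univ.filter (fun b : β => pb b = y), Real.exp (-(t * dist x (pb b))) :=
    (Finset.sum_fiberwise_of_maps_to (s := Finset.univ) (t := Finset.univ) (g := pb)
      (f := fun b => Real.exp (-(t * dist x (pb b)))) (fun b _ => Finset.mem_univ _)).symm
  rw [hfib]
  have hinner : ∀ y : UT N, ∑ b ∈ Finset.univ.filter (fun b : β => pb b = y), Real.exp (-(t * dist x (pb b)))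
      ≤ m * Real.exp (-(t * dist x y)) := by
    intro y
    have heq : ∑ b ∈ Finset.univ.filter (fun b : β => pb b = y), Real.exp (-(t * dist x (pb b)))
        = ∑ b ∈ Finset.univ.filter (fun b : β => pb b = y), Real.exp (-(t * dist x y)) :=
      Finset.sum_congr rfl fun b hb => by rw [(Finset.mem_filter.mp hb).2]
    rw [heq, Finset.sum_const, nsmul_eq_mul]
    exact mul_le_mul_of_nonneg_right (hm y) (Real.exp_pos _).le
  calc ∑ y : UT N, ∑ b ∈ Finset.univ.filter (fun b : β => pb b = y), Real.exp (-(t * dist x (pb b)))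
      ≤ ∑ y : UT N, m * Real.exp (-(t * dist x y)) := Finset.sum_le_sum fun y _ => hinner y
    _ = m * ∑ y : UT N, Real.exp (-(t * dist x y)) := by rw [Finset.mul_sum]
    _ ≤ m * B4Sect5Proof.latticeConst d t := by
        have htorus : ∑ y : UT N, Real.exp (-(t * dist x y)) ≤ B4Sect5Proof.latticeConst d t :=
          B4Sect5Torus.torusSum_le d (UT.one_le N) ht (UT.toSite N x)
        exact mul_le_mul_of_nonneg_left htorus (Nat.cast_nonneg m)

/-- The centres `ctrU N M₀` (mesh `M₀ ≥ 1`) are pairwise distinct torus sites. [folklore] -/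
theorem ctrU_injective {M₀ : ℕ} (hM : 1 ≤ M₀) : Function.Injective (B5TorusCover.ctrU N M₀) := by
  intro k k' h
  funext i
  have hi := congrArg (fun z : UT N => (UT.toSite N z i).val) h
  have hi' : M₀ * (k i).val = M₀ * (k' i).val := hi
  exact Fin.ext (Nat.eq_of_mul_eq_mul_left (by omega) hi')

/-- The coarse component family `(y, μ) ↦ ctrU y` of `B5AveragingTorus` (mesh `M₀ ≥ 1`): every torus site carries at
most one centre, so the fibres have size `≤ d`. [folklore] -/
theorem fibre_card_ctrU {M₀ : ℕ} (hM : 1 ≤ M₀) (z : UT N) :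
    ((Finset.univ.filter fun c : B5TorusCover.Ctr N M₀ × Fin d =>
      B5TorusCover.ctrU N M₀ c.1 = z).card : ℝ) ≤ d := by
  classical
  have hsub : (Finset.univ.filter fun c : B5TorusCover.Ctr N M₀ × Fin d => B5TorusCover.ctrU N M₀ c.1 = z)
      ⊆ (Finset.univ.filter fun y : B5TorusCover.Ctr N M₀ => B5TorusCover.ctrU N M₀ y = z) ×ˢ
        (Finset.univ : Finset (Fin d)) := by
    intro c hc
    rw [Finset.mem_product]
    exact ⟨Finset.mem_filter.mpr ⟨Finset.mem_univ _, (Finset.mem_filter.mp hc).2⟩, Finset.mem_univ _⟩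
  have hone : (Finset.univ.filter fun y : B5TorusCover.Ctr N M₀ => B5TorusCover.ctrU N M₀ y = z).card ≤ 1 := by
    apply Finset.card_le_one.mpr
    intro y hy y' hy'
    have h1 := (Finset.mem_filter.mp hy).2
    have h2 := (Finset.mem_filter.mp hy').2
    exact ctrU_injective hM (h1.trans h2.symm)
  calc ((Finset.univ.filter fun c : B5TorusCover.Ctr N M₀ × Fin d =>
        B5TorusCover.ctrU N M₀ c.1 = z).card : ℝ)
      ≤ ((Finset.univ.filter fun y : B5TorusCover.Ctr N M₀ => B5TorusCover.ctrU N M₀ y = z).card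
          * (Finset.univ : Finset (Fin d)).card : ℕ) := by
        exact_mod_cast (Finset.card_le_card hsub).trans (Finset.card_product _ _).le
    _ ≤ (1 * d : ℕ) := by
        exact_mod_cast Nat.mul_le_mul hone (by simp)
    _ = d := by simp

/-- **(1.126) on the unit torus of the averaging model** — `decay126` with the carrier `UT N`, any fine family
`πf : ι → UT N` with fibres of size `≤ m₁` (e.g. the components `UT N × Fin d`, `B5AveragingTorus.fibre_card_fst`,
`m₁ = d`) and any coarse family `σ : κ → UT N` with fibres `≤ m₂` (e.g. `(y, μ) ↦ ctrU y`, `fibre_card_ctrU`, `m₂ = d`):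
the profiles are `m·K_d` uniformly in the periods, so the rate and constant of (1.126) do not depend on the torus.
[cite: Balaban1984PropagatorsI, (1.126) p.38] -/
theorem decay126_torus {ι κ : Type*} [Fintype ι] [Fintype κ] [DecidableEq κ]
    {πf : ι → UT N} {σ : κ → UT N} {m₁ m₂ : ℕ}
    (hm₁ : ∀ y : UT N, ((Finset.univ.filter fun b : ι => πf b = y).card : ℝ) ≤ m₁)
    (hm₂ : ∀ y : UT N, ((Finset.univ.filter fun b : κ => σ b = y).card : ℝ) ≤ m₂)
    {G D D' : Matrix ι ι ℝ} {B : Matrix κ ι ℝ} {Bst : Matrix ι κ ℝ} {cG cD cD' cB cBst δ γ₀ : ℝ}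
    (hδ : 0 < δ) (hγ : 0 < γ₀)
    (hG : PosDecay (fun x y : UT N => dist x y) πf πf G cG δ)
    (hD : PosDecay (fun x y : UT N => dist x y) πf πf D cD δ)
    (hD' : PosDecay (fun x y : UT N => dist x y) πf πf D' cD' δ)
    (hB : PosDecay (fun x y : UT N => dist x y) σ πf B cB δ)
    (hBst : PosDecay (fun x y : UT N => dist x y) πf σ Bst cBst δ)
    (hM : QGQInverse.Coercive (B * G * G * Bst) γ₀) :
    PosDecay (fun x y : UT N => dist x y) πf πf (D * G * Bst * (B * G * G * Bst)⁻¹ * B * G * D')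
      (const126 (fun t => m₁ * B4Sect5Proof.latticeConst d t) (fun t => m₂ * B4Sect5Proof.latticeConst d t)
        cD cD' cG cB cBst γ₀ δ)
      (rate126 (fun t => m₁ * B4Sect5Proof.latticeConst d t) (fun t => m₂ * B4Sect5Proof.latticeConst d t)
        cG cB cBst γ₀ δ) :=
  decay126 isPseudoDist_torusDist
    (fun _ ht => mul_nonneg (Nat.cast_nonneg _) (B4Sect5Proof.latticeConst_nonneg d ht.le))
    (posProfile_torus πf hm₁)
    (fun _ ht => mul_nonneg (Nat.cast_nonneg _) (B4Sect5Proof.latticeConst_nonneg d ht.le))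
    (posProfile_torus σ hm₂) hδ hγ hG hD hD' hB hBst hM

/-- The constant `O(1)` of (1.126) in the torus model (fine fibres `≤ m₁`, coarse fibres `≤ m₂`). [folklore] -/
def torusConst126 (d m₁ m₂ : ℕ) (cD cD' cG cB cBst γ₀ δ : ℝ) : ℝ :=
  const126 (fun t => m₁ * B4Sect5Proof.latticeConst d t) (fun t => m₂ * B4Sect5Proof.latticeConst d t)
    cD cD' cG cB cBst γ₀ δ

/-- The rate `δ′₀` of (1.126) in the torus model. [folklore] -/
def torusRate126 (d m₁ m₂ : ℕ) (cG cB cBst γ₀ δ : ℝ) : ℝ :=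
  rate126 (fun t => m₁ * B4Sect5Proof.latticeConst d t) (fun t => m₂ * B4Sect5Proof.latticeConst d t)
    cG cB cBst γ₀ δ

/-- `0 < δ′₀` in the torus model. [folklore] -/
theorem torusRate126_pos (d m₁ m₂ : ℕ) {cG cB cBst γ₀ δ : ℝ} (hcG : 0 ≤ cG) (hcB : 0 ≤ cB) (hcBst : 0 ≤ cBst)
    (hγ : 0 < γ₀) (hδ : 0 < δ) : 0 < torusRate126 d m₁ m₂ cG cB cBst γ₀ δ :=
  rate126_pos (fun _ ht => mul_nonneg (Nat.cast_nonneg _) (B4Sect5Proof.latticeConst_nonneg d ht.le))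
    (fun _ ht => mul_nonneg (Nat.cast_nonneg _) (B4Sect5Proof.latticeConst_nonneg d ht.le)) hcG hcB hcBst hγ hδ

/-- **(1.128) in the torus averaging model with (1.126) DISCHARGED down to its constituents**: the bound
`‖h_{z₁}K(h_{z₂})A‖ ≤ O(M₀⁻¹)e^{−2δ₀|z₁−z₂|}(‖∇A‖ + ‖A‖)` of `B5AveragingTorus.h128_balaban_torus` for
`Δ_a = Δ + aQ*Q − ∂P∂*` ((1.121): *"(Δ − ∂P∂* + aQ*Q)hA"*), the kernel of `∂P∂*` being `D·G·Q′*·(Q′G′²Q′*)⁻¹·Q′·G·D′`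
with `G, D, D′, Q′, Q′*` decaying at rate `δ` and `Q′G′²Q′*` coercive — so that the ONLY non-structural hypotheses left
in the torus-model (1.128) leaf are (α) the kernel decay of `G′, ∂, Q′` and (β) `γ₀ ≤ Q′G′²Q′*` (cell GAPS G-B5-34);
`2δ₀ = twoDelta0 δ′₀ M₀` with `δ′₀ = torusRate126`, `O(1) = torusConst126` (coarse fibres `≤ m₂`, fine fibres `= d`).
[cite: Balaban1984PropagatorsI, (1.128) p.38] -/
theorem h128_of_constituents {M₀ n : ℕ} (hM : 1 ≤ M₀) (h2N : ∀ i, 2 * M₀ ≤ N i) (hn : 1 ≤ n)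
    (hq : ∀ i, 1 ≤ N i / n) {Dg : Module.End ℝ (EuclideanSpace ℝ (UT N × Fin d))}
    (hDg : ∀ A, Real.sqrt (B5Leibniz121.dirichlet (B5Leibniz121.axisWC (N := N) (κ := Fin d)) A) ≤ ‖Dg A‖)
    (a : ℝ) {κ : Type*} [Fintype κ] [DecidableEq κ] {σ : κ → UT N} {m₂ : ℕ}
    (hm₂ : ∀ y : UT N, ((Finset.univ.filter fun b : κ => σ b = y).card : ℝ) ≤ m₂)
    {G D D' : Matrix (UT N × Fin d) (UT N × Fin d) ℝ} {B : Matrix κ (UT N × Fin d) ℝ}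
    {Bst : Matrix (UT N × Fin d) κ ℝ} {cG cD cD' cB cBst δ γ₀ : ℝ} (hδ : 0 < δ) (hγ : 0 < γ₀)
    (hG : PosDecay (fun x y : UT N => dist x y) Prod.fst Prod.fst G cG δ)
    (hD : PosDecay (fun x y : UT N => dist x y) Prod.fst Prod.fst D cD δ)
    (hD' : PosDecay (fun x y : UT N => dist x y) Prod.fst Prod.fst D' cD' δ)
    (hB : PosDecay (fun x y : UT N => dist x y) σ Prod.fst B cB δ)
    (hBst : PosDecay (fun x y : UT N => dist x y) Prod.fst σ Bst cBst δ)
    (hco : QGQInverse.Coercive (B * G * G * Bst) γ₀)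
    (z₁ z₂ : B5TorusCover.Ctr N M₀) (A : EuclideanSpace ℝ (UT N × Fin d)) :
    ‖B5SmoothPartition.HSop N M₀ (fun p : UT N × Fin d => p.1) z₁
        (B5Local114.Kop
          (B5Commutator128.kerOp (fun i j => B5Leibniz121.lapKer B5Leibniz121.axisWC i j
              + a * B5Averaging120.gram120 ((n : ℝ) ^ d) (B5AveragingTorus.avgKer n) i j)
            + B5Commutator128.kerOp (fun i j => -((D * G * Bst * (B * G * G * Bst)⁻¹ * B * G * D') i j)))
          (B5SmoothPartition.HSop N M₀ fun p : UT N × Fin d => p.1) z₂ A)‖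
      ≤ (((4 * d / M₀ * Real.sqrt (2 * d) + 52 * d / (M₀ : ℝ) ^ 2) + 4 * d / M₀ * (4 * n) * |a|)
              * Real.exp (4 + 4 * n / M₀)
          + 4 * d / M₀ * torusConst126 d d m₂ cD cD' cG cB cBst γ₀ δ
            * (24 / (Real.exp 1 * torusRate126 d d m₂ cG cB cBst γ₀ δ))
            * (d * B4Sect5Proof.latticeConst d (torusRate126 d d m₂ cG cB cBst γ₀ δ / 8)) * Real.exp 7)
        * Real.exp (-(B5Walk131.twoDelta0 (torusRate126 d d m₂ cG cB cBst γ₀ δ) M₀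
            * dist (B5TorusCover.ctrU N M₀ z₁) (B5TorusCover.ctrU N M₀ z₂))) * (‖Dg A‖ + ‖A‖) := by
  have hdec := decay126_torus (B5AveragingTorus.fibre_card_fst (N := N)) hm₂ hδ hγ hG hD hD' hB hBst hco
  exact B5AveragingTorus.h128_balaban_torus hM h2N hn hq hDg a
    (k := fun i j => -((D * G * Bst * (B * G * G * Bst)⁻¹ * B * G * D') i j))
    (fun i j => by rw [abs_neg]; exact hdec.2 i j) hdec.1
    (torusRate126_pos d d m₂ hG.1 hB.1 hBst.1 hγ hδ) z₁ z₂ A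

/-- The variant (1.126) in the torus model: inputs = the decays (α) and the decay of `Mi = (Q′G′²Q′*)⁻¹` (α″).
[cite: Balaban1984PropagatorsI, (1.126) p.38] -/
theorem decay126_torus_of_inv {ι κ : Type*} [Fintype ι] [Fintype κ] {π : ι → UT N} {σ : κ → UT N} {m₁ m₂ : ℕ}
    (hm₁ : ∀ y : UT N, ((Finset.univ.filter fun b : ι => π b = y).card : ℝ) ≤ m₁)
    (hm₂ : ∀ y : UT N, ((Finset.univ.filter fun b : κ => σ b = y).card : ℝ) ≤ m₂)
    {G D D' : Matrix ι ι ℝ} {B : Matrix κ ι ℝ} {Bst : Matrix ι κ ℝ} {Mi : Matrix κ κ ℝ}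
    {cG cD cD' cB cBst cMi δ : ℝ} (hδ : 0 < δ)
    (hG : PosDecay (fun x y : UT N => dist x y) π π G cG δ)
    (hD : PosDecay (fun x y : UT N => dist x y) π π D cD δ)
    (hD' : PosDecay (fun x y : UT N => dist x y) π π D' cD' δ)
    (hB : PosDecay (fun x y : UT N => dist x y) σ π B cB δ)
    (hBst : PosDecay (fun x y : UT N => dist x y) π σ Bst cBst δ)
    (hMi : PosDecay (fun x y : UT N => dist x y) σ σ Mi cMi δ) :
    PosDecay (fun x y : UT N => dist x y) π π (D * G * Bst * Mi * B * G * D')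
      (const126i (fun t => m₁ * B4Sect5Proof.latticeConst d t) (fun t => m₂ * B4Sect5Proof.latticeConst d t)
        cD cD' cG cB cBst cMi δ) (δ / 64) :=
  decay126_of_inv isPseudoDist_torusDist
    (fun _ ht => mul_nonneg (Nat.cast_nonneg _) (B4Sect5Proof.latticeConst_nonneg d ht.le)) (posProfile_torus π hm₁)
    (fun _ ht => mul_nonneg (Nat.cast_nonneg _) (B4Sect5Proof.latticeConst_nonneg d ht.le)) (posProfile_torus σ hm₂)
    hδ hG hD hD' hB hBst hMi

/-- The constant of the variant in the torus model. [folklore] -/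
def torusConst126i (d m₁ m₂ : ℕ) (cD cD' cG cB cBst cMi δ : ℝ) : ℝ :=
  const126i (fun t => m₁ * B4Sect5Proof.latticeConst d t) (fun t => m₂ * B4Sect5Proof.latticeConst d t)
    cD cD' cG cB cBst cMi δ

/-- **(1.128) in the torus averaging model from kernel decays ONLY**: as `h128_of_constituents`, but with the decay of the
kernel of `Mi = (Q′G′²Q′*)⁻¹` (α″) as input in place of the coercivity `γ₀ ≤ Q′G′²Q′*` — so EVERY non-structural hypothesis of
the torus-model (1.128) leaf is now an exponential-decay estimate on the kernel of a NAMED operator: `G′`, `∂`-type `D, D′`,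
`Q′`, `Q′*` ((α): Theorem 1 / Lemma 2.4 of [2]) and `(Q′G′²Q′*)⁻¹` ((α″): (1.45) + analyticity; a kernel certificate of (α″) in the
multiplier model is `B5Torus145Decay.inverse145_torusKernelM_decay_torusMetric`; the identification of the averaging-model matrix
with that multiplier kernel — Fourier diagonalisation of block averaging — is NOT typed here, cell GAPS G-B5-34).
Constant `torusConst126i d d m₂ …`, rate `2δ₀ = twoDelta0 (δ/64) M₀`. [cite: Balaban1984PropagatorsI, (1.128) p.38, (1.126) p.38, p.25 l.35–36] -/
theorem h128_of_constituents_inv {M₀ n : ℕ} (hM : 1 ≤ M₀) (h2N : ∀ i, 2 * M₀ ≤ N i) (hn : 1 ≤ n)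
    (hq : ∀ i, 1 ≤ N i / n) {Dg : Module.End ℝ (EuclideanSpace ℝ (UT N × Fin d))}
    (hDg : ∀ A, Real.sqrt (B5Leibniz121.dirichlet (B5Leibniz121.axisWC (N := N) (κ := Fin d)) A) ≤ ‖Dg A‖)
    (a : ℝ) {κ : Type*} [Fintype κ] {σ : κ → UT N} {m₂ : ℕ}
    (hm₂ : ∀ y : UT N, ((Finset.univ.filter fun b : κ => σ b = y).card : ℝ) ≤ m₂)
    {G D D' : Matrix (UT N × Fin d) (UT N × Fin d) ℝ} {B : Matrix κ (UT N × Fin d) ℝ}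
    {Bst : Matrix (UT N × Fin d) κ ℝ} {Mi : Matrix κ κ ℝ} {cG cD cD' cB cBst cMi δ : ℝ} (hδ : 0 < δ)
    (hG : PosDecay (fun x y : UT N => dist x y) Prod.fst Prod.fst G cG δ)
    (hD : PosDecay (fun x y : UT N => dist x y) Prod.fst Prod.fst D cD δ)
    (hD' : PosDecay (fun x y : UT N => dist x y) Prod.fst Prod.fst D' cD' δ)
    (hB : PosDecay (fun x y : UT N => dist x y) σ Prod.fst B cB δ)
    (hBst : PosDecay (fun x y : UT N => dist x y) Prod.fst σ Bst cBst δ)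
    (hMi : PosDecay (fun x y : UT N => dist x y) σ σ Mi cMi δ)
    (z₁ z₂ : B5TorusCover.Ctr N M₀) (A : EuclideanSpace ℝ (UT N × Fin d)) :
    ‖B5SmoothPartition.HSop N M₀ (fun p : UT N × Fin d => p.1) z₁
        (B5Local114.Kop
          (B5Commutator128.kerOp (fun i j => B5Leibniz121.lapKer B5Leibniz121.axisWC i j
              + a * B5Averaging120.gram120 ((n : ℝ) ^ d) (B5AveragingTorus.avgKer n) i j)
            + B5Commutator128.kerOp (fun i j => -((D * G * Bst * Mi * B * G * D') i j)))
          (B5SmoothPartition.HSop N M₀ fun p : UT N × Fin d => p.1) z₂ A)‖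
      ≤ (((4 * d / M₀ * Real.sqrt (2 * d) + 52 * d / (M₀ : ℝ) ^ 2) + 4 * d / M₀ * (4 * n) * |a|)
              * Real.exp (4 + 4 * n / M₀)
          + 4 * d / M₀ * torusConst126i d d m₂ cD cD' cG cB cBst cMi δ
            * (24 / (Real.exp 1 * (δ / 64)))
            * (d * B4Sect5Proof.latticeConst d (δ / 64 / 8)) * Real.exp 7)
        * Real.exp (-(B5Walk131.twoDelta0 (δ / 64) M₀
            * dist (B5TorusCover.ctrU N M₀ z₁) (B5TorusCover.ctrU N M₀ z₂))) * (‖Dg A‖ + ‖A‖) := by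
  have hdec := decay126_torus_of_inv (B5AveragingTorus.fibre_card_fst (N := N)) hm₂ hδ hG hD hD' hB hBst hMi
  exact B5AveragingTorus.h128_balaban_torus hM h2N hn hq hDg a
    (k := fun i j => -((D * G * Bst * Mi * B * G * D') i j))
    (fun i j => by rw [abs_neg]; exact hdec.2 i j) hdec.1 (by linarith) z₁ z₂ A

end Torus

end

end Literature.MathematicalPhysics.QuantumFieldTheory.Balaban1983to89.B5Decay126
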